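import Summits.QuantumFields.BalabanUV.Beta.GAN24.HkGradientKingRate
import Summits.QuantumFields.BalabanUV.Beta.GAN24.HkStaircaseOneStep

/-!
# `BalabanUV.Beta.GAN24.SoftColumnGradKingOneStep` — binder row G-an2-4 ∕ (CONV-C), route R7 (ρ3) GRADIENT PART, road P2: the GRADIENT OF THE SOFT
# COLUMN `∂_ν(𝒢_aQ*)` (the differenced soft leg `∂_νM̃∕a` of the lineage's chains) AGAINST KING's PARENT — sup-entry currency, every torus,
# every `a > 0`, rate `θG(L,α)^k` — by leaf-04's split `colOp = H_k·c_k` read through the gradient: `∂′colOp′ − (∂colOp)∘par =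
# (∂′H′)·(c′ − c) + (∂′H′ − (∂H)∘par)·c`, with this lineage's gradient law for `H_k` (`HkGradientKingRate`) and NE2-P1's tower law for `c_k`

NOT IN PRINT; OUR PROOF ATTEMPT (unit `b2b-balaban-gan24-p2`, gen 31 = prover-b2b-balaban-gan24-p2-g31-0, road-P2 chair of row G-an2-4;
CRUX TEAM (2) under the ruling «YM REDIRECT TOWARDS THE SUMMIT», 2026-08-21).  HONEST FRAMING (cell contract, verbatim): «discharging
`BetaPertH` makes Bałaban's UV stability UNCONDITIONAL — a real constructive-QFT result; it is NOT the continuum limit and NOT the Clay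
problem.»  HONEST DEPENDENCY (verbatim): «continuum YM on T⁴ ⇐ BetaPertH ∧ nine spine estimates (0/9 proved); BetaPertH ⇐ (D1) ∧ (D4) ∧
CAP+tail; G-an2-4 gates asym, D1 and NE2/3/4.»  ABSOLUTE RULE: nothing printed is a hypothesis; no `def … : Prop`, no `sorry`; [folklore]
bookkeeping BY NAME over: this lineage's `HkGradientKingRate` (gradient law for `H_k`), leaf-04 g50's `SoftColumnTwoLevel` (`colOp`,
`colOp_eq_Hk_mul_covOp`), leaf-03's `SoftColumnSupLetter` (`norm_QGQ_apply_le`), b05's `B5Hk163TorusHolder` ∕ `…HolderDecay` (`dker`,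
`fdiff_HkOp_apply`, `norm_dker_bpt_le`), gan24-p3-g27's `HkKingOneStepSup` (`eq_bpt_and_par_eq`) and `HkStaircaseOneStep`
(`opNorm_covOp_succ_sub_le_lev`: NE2-P1's `opNorm_covBlev_succ_sub_le` in road P2's names).

## Content (0 sorry; `U = 1`, torus model, dimension `d+1 ≥ 1`)

 * §1 `fdiff_Hk_apply` (the entries of `∂_ν·Hk` are b05's `dker`), `sum_norm_dker_le` (row sums of the gradient kernel `≤ KDs(d)`, volume-uniform),
   `fdiff_colOp_eq` (`∂_ν·colOp = (∂_ν·Hk)·covOp`), **`fdiff_colOp_succ_sub_apply`**: the exact split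
   `(∂′colOp′)(X′,q) − (∂colOp)(par X′,q) = Σ_j ∂′H′(X′,j)(c′−c)(j,q) + Σ_j (∂′H′(X′,j) − ∂H(par X′,j))·c(j,q)`.
 * §2 **`norm_fdiff_colOp_sub_par_apply_le_lev`** (`L ≥ 2`, every `a > 0`, torus, level `k`, fine bond `X′` of level `k+1`, coarse bond `q`, `0 ≤ α < 1`):
   `‖(∂_ν^{(n_{k+1})}colOp_{k+1})(X′, q) − (∂_ν^{(n_k)}colOp_k)(par X′, q)‖ ≤ (KDs(d)·CQB(d+1,a) + a⁻¹·CGs(d,α,L))·θG(L,α)^k`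
   (`(L⁻¹)^k ≤ θG^k`); the `MsoftV = a•colOp` form **`norm_fdiff_MsoftV_sub_par_apply_le_lev`**.
HONEST.  Sup-ENTRY currency (no kernel decay in `|blk X′ − q|` here — that needs the kernel-currency law of `c′ − c`, road P2's Part 10, `a = 1` cubic
only); exponent per level `α∕2 < ½` inherited from `HkGradientKingRate` (interpolation artefact); constants crude.  NOT (CONV-C) as a whole, NEVER
«G-an2-4 closed», NOT NE2, NOT D1, NOT BetaPertH, NOT continuum, NOT Clay.  Text locations only: [Balaban1984PropagatorsI] (1.31) p. 23, (1.63) p. 28,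
(1.71) p. 29, (1.100)–(1.103) p. 35.
-/

noncomputable section

open scoped BigOperators Matrix Matrix.Norms.L2Operator
open Finset

namespace Summit.QuantumFields.BalabanUV.Beta.GAN24.SoftColumnGradKingOneStep

open Literature.MathematicalPhysics.QuantumFieldTheory.Balaban1983to89
open Literature.MathematicalPhysics.QuantumFieldTheory.Balaban1983to89.B5Prop11Plancherel (Tor fine fdiff)
open Literature.MathematicalPhysics.QuantumFieldTheory.Balaban1983to89.B4TorusKernel (periodConst)
open Literature.MathematicalPhysics.QuantumFieldTheory.Balaban1983to89.B4TorusKernel.MultiPeriod (torusSupNorm)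
open Literature.MathematicalPhysics.QuantumFieldTheory.Balaban1983to89.B4Sect5Proof (latticeConst latticeConst_nonneg)
open Literature.MathematicalPhysics.QuantumFieldTheory.Balaban1983to89.B5Block118 (bpt)
open Literature.MathematicalPhysics.QuantumFieldTheory.Balaban1983to89.B5Blocks16 (blockOf)
open Literature.MathematicalPhysics.QuantumFieldTheory.Balaban1983to89.B6LowerBound2153Torus (toT rep toT_rep)
open Literature.MathematicalPhysics.QuantumFieldTheory.Balaban1983to89.B5G183RateUnitTower (lev lev_neZero)
open Literature.MathematicalPhysics.QuantumFieldTheory.Balaban1983to89.B5Hk163Torus (HkOp)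
open Literature.MathematicalPhysics.QuantumFieldTheory.Balaban1983to89.B5Hk163Form166 (HkOp_eq_Hk)
open Literature.MathematicalPhysics.QuantumFieldTheory.Balaban1983to89.B5Hk163TorusHolder (dker fdiff_HkOp_apply)
open Literature.MathematicalPhysics.QuantumFieldTheory.Balaban1983to89.B5Hk163TorusHolderDecay (CdecD CdecD_nonneg norm_dker_bpt_le)
open Literature.MathematicalPhysics.QuantumFieldTheory.Balaban1983to89.B5Hk163TorusHolderRate (sum_exp_torusSupNorm_sub_rep_le)
open Literature.MathematicalPhysics.QuantumFieldTheory.Balaban1983to89.Beta.FluctuationProjection (Hk digitOf bpt_blockOf_digitOf)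
open Summit.QuantumFields.BalabanUV.T4Continuum.BalabanAveragedTowerModes (par)
open Summit.QuantumFields.BalabanUV.T4Continuum.BalabanAveragedTowerUnit (one_le_lev' cast_lev')
open Summit.QuantumFields.BalabanUV.T4Continuum.BalabanLineAverage (CQB CQB_nonneg)
open Summit.QuantumFields.BalabanUV.T4Continuum.BalabanAveragedTowerUnit (norm_entry_le_opNorm)
open Summit.QuantumFields.BalabanUV.Beta.GAN24.AveragedPropagatorTwoLevel (covOp)
open Summit.QuantumFields.BalabanUV.Beta.GAN24.AveragedPropagatorInverseUniform (covOp_eq_QGQ)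
open Summit.QuantumFields.BalabanUV.Beta.GAN24.SoftVectorMinimiserTwoLevel (MsoftV)
open Summit.QuantumFields.BalabanUV.Beta.GAN24.SoftColumnTwoLevel (colOp MsoftV_eq_smul_colOp colOp_eq_Hk_mul_covOp)
open Summit.QuantumFields.BalabanUV.Beta.GAN24.SoftColumnSupLetter (norm_QGQ_apply_le)
open Summit.QuantumFields.BalabanUV.Beta.GAN24.HkKingOneStep (dec dec_pos)
open Summit.QuantumFields.BalabanUV.Beta.GAN24.HkKingOneStepSup (parDigit eq_bpt_and_par_eq)
open Summit.QuantumFields.BalabanUV.Beta.GAN24.HkStaircaseOneStep (opNorm_covOp_succ_sub_le_lev)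
open Summit.QuantumFields.BalabanUV.Beta.GAN24.HkGradientKingRate (thetaG thetaG_pos thetaG_le_one CG CGs CGs_nonneg dec_eq
  sum_norm_dker_par_sub_le_lev)

variable {d : ℕ}

/-! ## §1 The gradient of the column: entries, row sums, the exact split -/

/-- the row-sum constant of the gradient kernel: `KDs(d) = CdecD(d)·(d+1)·latticeConst(d+1, dec d)`. OURS. [folklore] -/
def KDs (d : ℕ) : ℝ := CdecD d * ((d + 1) * latticeConst (d + 1) (dec d))

/-- `0 ≤ KDs`. [folklore] -/
theorem KDs_nonneg (d : ℕ) : 0 ≤ KDs d := by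
  have h1 : 0 ≤ CdecD d := CdecD_nonneg
  have h3 : (0 : ℝ) ≤ latticeConst (d + 1) (dec d) := latticeConst_nonneg _ (dec_pos d).le
  unfold KDs; positivity

section Level

variable (n : ℕ) [NeZero n] (M : Fin (d + 1) → ℕ) [hM : ∀ μ, NeZero (M μ)] (a : ℝ)

/-- the entries of `∂_ν·H_k` (road P2 ∕ leaf-04's `Hk`) ARE b05's gradient kernel `dker`. [folklore] -/
theorem fdiff_Hk_apply (ha : 0 < a) (ν : Fin (d + 1)) (X : Tor (fine n M) × Fin (d + 1)) (j : Tor M × Fin (d + 1)) :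
    (fdiff (fine n M) (n : ℂ) ν * Hk n (Nat.one_le_iff_ne_zero.mpr (NeZero.ne n)) M a ha) X j = dker n M X.2 j.2 ν X.1 j.1 := by
  rw [← HkOp_eq_Hk]
  obtain ⟨x, μ⟩ := X
  obtain ⟨y, lam⟩ := j
  exact fdiff_HkOp_apply n M μ lam ν x y

/-- **ROW SUMS OF THE GRADIENT KERNEL**: `Σ_j ‖∂_νH_n(X, j)‖ ≤ KDs(d)` for every fine bond `X` — every torus (b05's `norm_dker_bpt_le` + King's lattice
constant). [folklore] -/
theorem sum_norm_dker_le (ν : Fin (d + 1)) (X : Tor (fine n M) × Fin (d + 1)) :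
    ∑ j : Tor M × Fin (d + 1), ‖dker n M X.2 j.2 ν X.1 j.1‖ ≤ KDs d := by
  obtain ⟨x, μ⟩ := X
  have hx : x = bpt n M (toT M (rep M (blockOf n M x))) (digitOf n M x) := by rw [toT_rep, bpt_blockOf_digitOf]
  set x' := rep M (blockOf n M x)
  rw [Fintype.sum_prod_type]
  calc ∑ y : Tor M, ∑ lam : Fin (d + 1), ‖dker n M μ lam ν x y‖
      ≤ ∑ y : Tor M, ∑ _lam : Fin (d + 1), CdecD d * Real.exp (-(dec d * torusSupNorm M (x' - rep M y))) := by
        refine Finset.sum_le_sum fun y _ => Finset.sum_le_sum fun lam _ => ?_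
        have h := norm_dker_bpt_le n M μ lam ν (digitOf n M x) x' (rep M y)
        rw [← hx, toT_rep, ← dec_eq] at h
        exact h
    _ = CdecD d * ((d + 1) * ∑ y : Tor M, Real.exp (-(dec d * torusSupNorm M (x' - rep M y)))) := by
        simp only [Finset.sum_const, Finset.card_univ, Fintype.card_fin, nsmul_eq_mul, Finset.mul_sum]
        refine Finset.sum_congr rfl fun y _ => ?_
        push_cast; ring
    _ ≤ CdecD d * ((d + 1) * latticeConst (d + 1) (dec d)) :=
        mul_le_mul_of_nonneg_left (mul_le_mul_of_nonneg_left (sum_exp_torusSupNorm_sub_rep_le M (dec_pos d) x') (by positivity))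
          CdecD_nonneg
    _ = KDs d := rfl

/-- `∂_ν·colOp = (∂_ν·H_k)·covOp` (leaf-04's `colOp = H_k·covOp`). [folklore] -/
theorem fdiff_colOp_eq (ha : 0 < a) (ν : Fin (d + 1)) :
    fdiff (fine n M) (n : ℂ) ν * colOp n M a
      = (fdiff (fine n M) (n : ℂ) ν * Hk n (Nat.one_le_iff_ne_zero.mpr (NeZero.ne n)) M a ha) * covOp n M a := by
  rw [colOp_eq_Hk_mul_covOp n M a (Nat.one_le_iff_ne_zero.mpr (NeZero.ne n)) ha, Matrix.mul_assoc]

/-- the entry of the gradient of the column: `(∂_ν colOp)(X, q) = Σ_j dker(X, j)·c(j, q)`. [folklore] -/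
theorem fdiff_colOp_apply (ha : 0 < a) (ν : Fin (d + 1)) (X : Tor (fine n M) × Fin (d + 1)) (q : Tor M × Fin (d + 1)) :
    (fdiff (fine n M) (n : ℂ) ν * colOp n M a) X q = ∑ j : Tor M × Fin (d + 1), dker n M X.2 j.2 ν X.1 j.1 * covOp n M a j q := by
  rw [fdiff_colOp_eq n M a ha ν, Matrix.mul_apply]
  exact Finset.sum_congr rfl fun j _ => by rw [fdiff_Hk_apply n M a ha ν X j]

/-- `|c_n(j, q)| ≤ a⁻¹` ((1.100), leaf-03's `norm_QGQ_apply_le` through `covOp_eq_QGQ`). [folklore] -/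
theorem norm_covOp_apply_le (ha : 0 < a) (j q : Tor M × Fin (d + 1)) : ‖covOp n M a j q‖ ≤ a⁻¹ := by
  rw [covOp_eq_QGQ n M a (Nat.one_le_iff_ne_zero.mpr (NeZero.ne n)) ha]
  exact norm_QGQ_apply_le M a ha n _ j q

end Level

section TwoLevel

variable {N R : ℕ} [NeZero N] [NeZero R] (M : Fin (d + 1) → ℕ) [hM : ∀ μ, NeZero (M μ)] (a : ℝ)

/-- **THE EXACT SPLIT OF THE GRADIENT OF THE COLUMN** against King's parent:
`(∂′colOp′)(X′,q) − (∂colOp)(par X′,q) = Σ_j ∂′H′(X′,j)·(c′ − c)(j,q) + Σ_j (∂′H′(X′,j) − ∂H(par X′,j))·c(j,q)`. [folklore] -/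
theorem fdiff_colOp_succ_sub_apply (ha : 0 < a) (ν : Fin (d + 1)) (X' : Tor (fine (R * N) M) × Fin (d + 1)) (q : Tor M × Fin (d + 1)) :
    (fdiff (fine (R * N) M) ((R * N : ℕ) : ℂ) ν * colOp (R * N) M a) X' q
        - (fdiff (fine N M) (N : ℂ) ν * colOp N M a) (par N R M X'.1, X'.2) q
      = ∑ j : Tor M × Fin (d + 1), dker (R * N) M X'.2 j.2 ν X'.1 j.1 * (covOp (R * N) M a - covOp N M a) j q
        + ∑ j : Tor M × Fin (d + 1), (dker (R * N) M X'.2 j.2 ν X'.1 j.1 - dker N M X'.2 j.2 ν (par N R M X'.1) j.1) * covOp N M a j q := by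
  rw [fdiff_colOp_apply (R * N) M a ha ν X' q, fdiff_colOp_apply N M a ha ν (par N R M X'.1, X'.2) q, ← Finset.sum_sub_distrib,
    ← Finset.sum_add_distrib]
  refine Finset.sum_congr rfl fun j _ => ?_
  rw [Matrix.sub_apply]
  ring

end TwoLevel

/-! ## §2 Along the tower: the gradient of the soft column against King's parent, every `a > 0`, every torus -/

section Tower

/-- `(L⁻¹)^k ≤ θG(L,α)^k` for `L ≥ 1`, `α < 1` (`θG = (L⁻¹)^{α∕2} ≥ L⁻¹`). [folklore] -/
theorem inv_pow_le_thetaG_pow {L : ℕ} (hL : 1 ≤ L) (k : ℕ) {α : ℝ} (hα1 : α < 1) :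
    ((L : ℝ)⁻¹) ^ k ≤ thetaG L α ^ k := by
  have hL0 : (0 : ℝ) < L := by exact_mod_cast hL
  have hx0 : 0 < ((L : ℝ)⁻¹) := inv_pos.mpr hL0
  have hx1 : ((L : ℝ)⁻¹) ≤ 1 := inv_le_one_of_one_le₀ (by exact_mod_cast hL)
  refine pow_le_pow_left₀ hx0.le ?_ k
  unfold thetaG
  conv_lhs => rw [← Real.rpow_one ((L : ℝ)⁻¹)]
  exact Real.rpow_le_rpow_of_exponent_ge hx0 hx1 (by linarith)

variable (L : ℕ) [NeZero L] (M : Fin (d + 1) → ℕ) [hM : ∀ μ, NeZero (M μ)] (a : ℝ)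

/-- **THE GRADIENT OF THE SOFT COLUMN AGAINST KING's PARENT, sup-ENTRY CURRENCY** (`L ≥ 2`, every `a > 0`, every torus, every level `k`, fine bond `X′`
of level `k+1`, coarse bond `q`, `0 ≤ α < 1`):
`‖(∂_ν^{(n_{k+1})}colOp_{k+1})(X′, q) − (∂_ν^{(n_k)}colOp_k)(par X′, q)‖ ≤ (KDs(d)·CQB(d+1,a) + a⁻¹·CGs(d,α,L))·θG(L,α)^k`.
[cite: Balaban1984PropagatorsI, (1.31) p.23, (1.63) p.28, (1.100)–(1.103) p.35] [folklore] -/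
theorem norm_fdiff_colOp_sub_par_apply_le_lev (hL : 2 ≤ L) (ha : 0 < a) (k : ℕ) (ν : Fin (d + 1))
    (X' : Tor (fine (L * lev L k) M) × Fin (d + 1)) (q : Tor M × Fin (d + 1)) {α : ℝ} (hα0 : 0 ≤ α) (hα1 : α < 1) :
    ‖(fdiff (fine (L * lev L k) M) ((L * lev L k : ℕ) : ℂ) ν * colOp (L * lev L k) M a) X' q
        - (fdiff (fine (lev L k) M) ((lev L k : ℕ) : ℂ) ν * colOp (lev L k) M a) (par (lev L k) L M X'.1, X'.2) q‖
      ≤ (KDs d * CQB (d + 1) a + a⁻¹ * CGs d α L) * thetaG L α ^ k := by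
  have hL1 : 1 ≤ L := le_trans (by norm_num) hL
  have hθ : 0 ≤ thetaG L α ^ k := pow_nonneg (thetaG_pos hL1 α).le k
  rw [fdiff_colOp_succ_sub_apply M a ha ν X' q]
  -- first term: row sums of `dker′` × operator norm of `c′ − c`
  have hc := opNorm_covOp_succ_sub_le_lev L M a ha k
  have h1 : ‖∑ j : Tor M × Fin (d + 1), dker (L * lev L k) M X'.2 j.2 ν X'.1 j.1 * (covOp (L * lev L k) M a - covOp (lev L k) M a) j q‖
      ≤ KDs d * (CQB (d + 1) a * ((L : ℝ)⁻¹) ^ k) := by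
    calc _ ≤ ∑ j : Tor M × Fin (d + 1), ‖dker (L * lev L k) M X'.2 j.2 ν X'.1 j.1 * (covOp (L * lev L k) M a - covOp (lev L k) M a) j q‖ := norm_sum_le _ _
      _ ≤ ∑ j : Tor M × Fin (d + 1), ‖dker (L * lev L k) M X'.2 j.2 ν X'.1 j.1‖ * ‖covOp (L * lev L k) M a - covOp (lev L k) M a‖ :=
          Finset.sum_le_sum fun j _ => by
            rw [norm_mul]; exact mul_le_mul_of_nonneg_left (norm_entry_le_opNorm _ j q) (norm_nonneg _)
      _ = (∑ j : Tor M × Fin (d + 1), ‖dker (L * lev L k) M X'.2 j.2 ν X'.1 j.1‖) * ‖covOp (L * lev L k) M a - covOp (lev L k) M a‖ := by rw [Finset.sum_mul]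
      _ ≤ KDs d * (CQB (d + 1) a * ((L : ℝ)⁻¹) ^ k) :=
          mul_le_mul (sum_norm_dker_le (L * lev L k) M ν X') hc (norm_nonneg _) (KDs_nonneg d)
  -- second term: row sums of the gradient one-step difference × `|c| ≤ a⁻¹`
  have h2 : ‖∑ j : Tor M × Fin (d + 1), (dker (L * lev L k) M X'.2 j.2 ν X'.1 j.1 - dker (lev L k) M X'.2 j.2 ν (par (lev L k) L M X'.1) j.1) * covOp (lev L k) M a j q‖
      ≤ CGs d α L * thetaG L α ^ k * a⁻¹ := by
    calc _ ≤ ∑ j : Tor M × Fin (d + 1), ‖(dker (L * lev L k) M X'.2 j.2 ν X'.1 j.1 - dker (lev L k) M X'.2 j.2 ν (par (lev L k) L M X'.1) j.1) * covOp (lev L k) M a j q‖ :=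
          norm_sum_le _ _
      _ ≤ ∑ j : Tor M × Fin (d + 1), ‖dker (L * lev L k) M X'.2 j.2 ν X'.1 j.1 - dker (lev L k) M X'.2 j.2 ν (par (lev L k) L M X'.1) j.1‖ * a⁻¹ :=
          Finset.sum_le_sum fun j _ => by
            rw [norm_mul]; exact mul_le_mul_of_nonneg_left (norm_covOp_apply_le (lev L k) M a ha j q) (norm_nonneg _)
      _ = (∑ j : Tor M × Fin (d + 1), ‖dker (L * lev L k) M X'.2 j.2 ν X'.1 j.1 - dker (lev L k) M X'.2 j.2 ν (par (lev L k) L M X'.1) j.1‖) * a⁻¹ := by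
          rw [Finset.sum_mul]
      _ ≤ CGs d α L * thetaG L α ^ k * a⁻¹ :=
          mul_le_mul_of_nonneg_right (sum_norm_dker_par_sub_le_lev L M hL k X' ν hα0 hα1) (inv_nonneg.mpr ha.le)
  have hpow := inv_pow_le_thetaG_pow hL1 k hα1
  have hK := KDs_nonneg d
  have hQ := CQB_nonneg (d + 1) a
  calc _ ≤ KDs d * (CQB (d + 1) a * ((L : ℝ)⁻¹) ^ k) + CGs d α L * thetaG L α ^ k * a⁻¹ := (norm_add_le _ _).trans (add_le_add h1 h2)
    _ ≤ KDs d * (CQB (d + 1) a * thetaG L α ^ k) + CGs d α L * thetaG L α ^ k * a⁻¹ := by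
        have := mul_le_mul_of_nonneg_left (mul_le_mul_of_nonneg_left hpow hQ) hK
        linarith
    _ = (KDs d * CQB (d + 1) a + a⁻¹ * CGs d α L) * thetaG L α ^ k := by ring

/-- the `MsoftV = a•colOp` form (the lineage's soft leg `M̃`): `‖(∂′M̃′)(X′,q) − (∂M̃)(par X′,q)‖ ≤ (a·KDs·CQB + CGs)·θG^k`. [folklore] -/
theorem norm_fdiff_MsoftV_sub_par_apply_le_lev (hL : 2 ≤ L) (ha : 0 < a) (k : ℕ) (ν : Fin (d + 1))
    (X' : Tor (fine (L * lev L k) M) × Fin (d + 1)) (q : Tor M × Fin (d + 1)) {α : ℝ} (hα0 : 0 ≤ α) (hα1 : α < 1) :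
    ‖(fdiff (fine (L * lev L k) M) ((L * lev L k : ℕ) : ℂ) ν * MsoftV (L * lev L k) M a) X' q
        - (fdiff (fine (lev L k) M) ((lev L k : ℕ) : ℂ) ν * MsoftV (lev L k) M a) (par (lev L k) L M X'.1, X'.2) q‖
      ≤ (a * (KDs d * CQB (d + 1) a) + CGs d α L) * thetaG L α ^ k := by
  have e : ∀ (n : ℕ) [NeZero n] (X : Tor (fine n M) × Fin (d + 1)),
      (fdiff (fine n M) (n : ℂ) ν * MsoftV n M a) X q = (a : ℂ) * (fdiff (fine n M) (n : ℂ) ν * colOp n M a) X q := by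
    intro n _ X
    rw [MsoftV_eq_smul_colOp, Matrix.mul_smul, Matrix.smul_apply, smul_eq_mul]
  rw [e, e, ← mul_sub, norm_mul, Complex.norm_real, Real.norm_of_nonneg ha.le]
  calc a * _ ≤ a * ((KDs d * CQB (d + 1) a + a⁻¹ * CGs d α L) * thetaG L α ^ k) :=
        mul_le_mul_of_nonneg_left (norm_fdiff_colOp_sub_par_apply_le_lev L M a hL ha k ν X' q hα0 hα1) ha.le
    _ = (a * (KDs d * CQB (d + 1) a) + CGs d α L) * thetaG L α ^ k := by field_simp

end Tower

end Summit.QuantumFields.BalabanUV.Beta.GAN24.SoftColumnGradKingOneStep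

end
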